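import Mathlib
import Summits.CriticalPhenomena.CardyFormulaZ2.Theorems.CardyFlipRussoSquareFromVoronoiHubDefs
import Summits.CriticalPhenomena.CardyFormulaZ2.Theorems.CardyFlipRussoSquareFromVoronoiHubFaithfulPart1
import Summits.CriticalPhenomena.CardyFormulaZ2.Theorems.CardyFlipRussoSquareFromVoronoiHubSmallCellsPart4
import Literature.Probability.Percolation.VoronoiCrossing
import Literature.Analysis.FunctionSpaces.PoissonPointProcess

/-!
# K1 vocabulary at cell scale `ε = δ^{1/8}`: thresholds, the no-defect event, fat tubes, specs,
# and measurability of the block crossing event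

Crux `Summit.CriticalPhenomena.CardyFormulaZ2.Theses.CardyFlipRusso.SquareFromVoronoiHub`
(stmt-CriticalPhenomena-6434), line `Sketch` (card `voronoi-blocks-on-fixed-gs`), stub family K1
("faithful discretisation").  DEFINITIONS MODULE of the reshaped K1 (lead
`prover-line-stmt-CriticalPhenomena-6434-0`, cycle 2; design `Cruxes/SquareFromVoronoiHub/Lines/Sketch.lean`,
Section A): the objects over which the four registered K1 stubs `stub_perturbedRectangles` (S1),
`stub_noDefect` (S2), `stub_fatTube`, `stub_sandwich_of` (S3 + S4) are stated, so that their
Theorems files can refer to them BY NAME.  All notions are parametrised and `Set`-valued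
(membership form), nothing is asserted beyond elementary lemmas:

* thresholds `cellRad δ = δ^{3/32}` (`ρ`, no empty `ρ`-disc), `sepRad δ = δ^{3/8}` (`r₂`, nuclei
  separation), `edgeLen δ = δ^{5/8}` (`ℓ₀`, no shorter pseudo-edge) — as powers of `ε = δ^{1/8}`:
  `ε^{3/4}`, `ε³`, `ε⁵`; failure probabilities are unweighted Poisson first moments / voids;
* `noDefect V ρ r₂ ℓ₀ : Set (Set ℂ × Set ℂ)` — the bulk no-defect event of a pair of nucleus sets in
  the window `V` ((o) both colours present, (i) no empty disc, (ii) separation, (ii') no shared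
  nucleus, (iii) no short pseudo-edge), colour-symmetric (`mem_noDefect_swap`);
* `strictBlack B W` (strictly closer to `B`), `tubeMargins B W ρ γ : Set ℝ` (margins `μ` of a
  strictly black fat tube shadowing the path `γ`), `hblack_of_ball_subset` (Part 6's `hblack`);
* `lowerMargins R R₁ F₀ F₂`, `upperMargins R R₂ : Set ℝ` — the metric cap/collar clauses of the lower
  perturbed rectangle and the topological crossing clause of the upper one;
* `measurableSet_blockCrossing` — the crude block crossing event is measurable in the pair law
  (finite window `SmallCells.crudeCrossing_determinedBy` + `measurable_infDist_coe`), which makes the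
  outer-measure split of the S4 bookkeeping valid.

Sources: Bollobás–Riordan, *Percolation* (2006), Ch. 7 (19)/Lemma 14 (sandwich by perturbed marked
domains), Ch. 8 §8.3 (fine lattice approximations of Voronoi percolation); Pommerenke (1992) Cor. 2.9
(Schoenflies, for the perturbed rectangles).
-/

noncomputable section

namespace Summit.CriticalPhenomena.CardyFormulaZ2.Cruxes.SquareFromVoronoiHub.VoronoiBlocks.Faithful

open scoped Topology Pointwise
open Set Filter MeasureTheory Metric
open UpperHalfPlane (upperHalfPlaneSet)
open Literature.Analysis.FunctionSpaces (PointConfig IsPoissonPointProcess)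
open Literature.Probability.Percolation (SiteConfig blackRegion voronoiCrossing)
open Literature.Probability.RandomPlanarGeometry (ConformalRectangle ConformalEquiv cardyFunction
  crossRatio)

/-! ### The thresholds (functions of the mesh `δ`; `ε = δ^{1/8}`) -/

/-- `ρ(δ) = ε^{3/4} = δ^{3/32}`: radius below which no disc of the window is empty of nuclei
(hence cells have diameter `< 2ρ`). [folklore] -/
def cellRad (δ : ℝ) : ℝ := δ ^ (3 / 32 : ℝ)

/-- `r₂(δ) = ε³ = δ^{3/8}`: minimal separation of two nuclei in the window (hence every cell
contains the disc of radius `r₂/2` about its nucleus, and cell angles have `sin ≥ r₂/(2ρ)`). [folklore] -/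
def sepRad (δ : ℝ) : ℝ := δ ^ (3 / 8 : ℝ)

/-- `ℓ₀(δ) = ε⁵ = δ^{5/8}`: minimal length of a (pseudo-)Voronoi edge in the window. [folklore] -/
def edgeLen (δ : ℝ) : ℝ := δ ^ (5 / 8 : ℝ)

/-! ### The no-defect event (plain point sets; `Set`-valued, membership form) -/

/-- **No sub-mesh Voronoi defect** in the window `V` at thresholds `ρ, r₂, ℓ₀`, as the SET of
admissible pairs `X = (B, W)` of black/white nucleus sets: (o) both colours occur in `V`; (i) every
point of `V` has a nucleus at distance `< ρ`; (ii) distinct nuclei, one of them in `V`, are at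
distance `≥ r₂`; (ii') no point of `V` is a nucleus of both colours; (iii) NO SHORT PSEUDO-EDGE:
for pairwise distinct nuclei `p, q, r, r'` (`p ∈ V`) and centres `v`, `v'` with
`|pv| = |qv| = |rv| ≤ 2ρ` and `|pv'| = |qv'| = |r'v'| ≤ 2ρ` one has `|vv'| ≥ ℓ₀` (so every
Voronoi vertex near `V` carries exactly three cells and every Voronoi edge has length `≥ ℓ₀`).
Similarity-invariant under `z ↦ s z`, `s > 0` (all clauses are metric).  `Set`-valued (like
`crudeCrossing`) so that no proposition is DEFINED under `Summits/`. [folklore] -/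
def noDefect (V : Set ℂ) (ρ r₂ ℓ₀ : ℝ) : Set (Set ℂ × Set ℂ) :=
  {X | ((X.1 ∩ V).Nonempty ∧ (X.2 ∩ V).Nonempty) ∧
    (∀ z ∈ V, ∃ p ∈ X.1 ∪ X.2, dist z p < ρ) ∧
    (∀ p ∈ X.1 ∪ X.2, ∀ q ∈ X.1 ∪ X.2, p ∈ V → dist p q < r₂ → p = q) ∧
    (∀ p ∈ V, p ∈ X.1 → p ∉ X.2) ∧
    (∀ p ∈ X.1 ∪ X.2, ∀ q ∈ X.1 ∪ X.2, ∀ r ∈ X.1 ∪ X.2, ∀ r' ∈ X.1 ∪ X.2, ∀ v v' : ℂ, p ∈ V →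
      p ≠ q → p ≠ r → q ≠ r → p ≠ r' → q ≠ r' → r ≠ r' →
      dist p v = dist q v → dist q v = dist r v → dist p v ≤ 2 * ρ →
      dist p v' = dist q v' → dist q v' = dist r' v' → dist p v' ≤ 2 * ρ →
      ℓ₀ ≤ dist v v')}

/-- The no-defect event is symmetric in the two colours. [folklore] -/
theorem mem_noDefect_swap {B W V : Set ℂ} {ρ r₂ ℓ₀ : ℝ} (h : (B, W) ∈ noDefect V ρ r₂ ℓ₀) :
    (W, B) ∈ noDefect V ρ r₂ ℓ₀ := by
  obtain ⟨⟨hB, hW⟩, h1, h2, h3, h4⟩ := h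
  refine ⟨⟨hW, hB⟩, ?_, ?_, ?_, ?_⟩
  · simpa only [union_comm] using h1
  · simpa only [union_comm] using h2
  · exact fun p hpV hpW hpB => h3 p hpV hpB hpW
  · simpa only [union_comm] using h4

/-! ### Robustly coloured paths -/

/-- The STRICTLY black points: closer to `B` than to `W` (the interior of the black region away
from ties; for the white version swap `B` and `W`). [folklore] -/
def strictBlack (B W : Set ℂ) : Set ℂ := {z | infDist z B < infDist z W}

/-- Strictly black points are black. [folklore] -/
theorem strictBlack_subset_blackRegion (B W : Set ℂ) : strictBlack B W ⊆ blackRegion B W :=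
  fun _ hz => le_of_lt (α := ℝ) hz

/-- **Fat-tube margins** of the path `γ` at cell radius `ρ`: the set of `μ` for which there is a
path `γ'` whose open `μ`-balls are strictly black, from within `4ρ` of the start of `γ` to within
`4ρ` of its end, every point of `γ'` within `4ρ` of `γ` (`Set`-valued, membership form). [folklore] -/
def tubeMargins (B W : Set ℂ) (ρ : ℝ) {x y : ℂ} (γ : Path x y) : Set ℝ :=
  {μ | ∃ (x' y' : ℂ) (γ' : Path x' y'), dist x' x ≤ 4 * ρ ∧ dist y' y ≤ 4 * ρ ∧
    (∀ t, ∃ s, dist (γ' t) (γ s) ≤ 4 * ρ) ∧ ∀ t, ball (γ' t) μ ⊆ strictBlack B W}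

/-- The robust-blackness hypothesis `hblack` of Part 6 (`blockConfig_mem_crudeCrossing_of_*`) from
strictly black `μ`-balls with `δ/2 < μ`. [folklore] -/
theorem hblack_of_ball_subset {B W : Set ℂ} {δ μ : ℝ} (hμ : δ / 2 < μ) {x y : ℂ} {γ : Path x y}
    (h : ∀ t, ball (γ t) μ ⊆ strictBlack B W) (t : unitInterval) (v : (ℤ × ℤ) ⊕ (ℤ × ℤ))
    (hv : dist (γ t) ((δ : ℂ) * zGs v) ≤ δ / 2) : (δ : ℂ) * zGs v ∈ blackRegion B W :=
  strictBlack_subset_blackRegion B W (h t (mem_ball'.2 (hv.trans_lt hμ)))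

/-! ### Specifications of the perturbed rectangles (`Set ℝ` of admissible margins `r`) -/

/-- **Lower spec** (what S3 consumes of `R₁`; the set of admissible margins `r > 0`): closed
disjoint cap sets `F₀ ⊇` the `r`-neighbourhood of `R₁.arc 0` and `F₂ ⊇` that of `R₁.arc 2`,
both neighbourhoods off `closure Ω`; `F₀` at distance `≥ r` from `(cd)`, `F₂` from `(ab)`; the
`r`-neighbourhood of `closure R₁` is at distance `≥ r` from `(bc)`, `(da)` and its
off-`closure Ω` part lies in `F₀ ∪ F₂` (these are `hout, h₀, h₂, hx, h1, h3` of Part 6 for any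
path within `r` of `closure R₁`). [folklore] -/
def lowerMargins (R R₁ : ConformalRectangle) (F₀ F₂ : Set ℂ) : Set ℝ :=
  {r | 0 < r ∧ IsClosed F₀ ∧ IsClosed F₂ ∧ Disjoint F₀ F₂ ∧
    (∀ z ∈ F₀, r ≤ infDist z (R.arc 2)) ∧ (∀ z ∈ F₂, r ≤ infDist z (R.arc 0)) ∧
    (∀ z, infDist z (closure R₁.carrier) ≤ r → r ≤ infDist z (R.arc 1) ∧ r ≤ infDist z (R.arc 3)) ∧
    (∀ z, infDist z (closure R₁.carrier) ≤ r → z ∉ closure R.carrier → z ∈ F₀ ∪ F₂) ∧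
    (∀ z, infDist z (R₁.arc 0) ≤ r → z ∉ closure R.carrier ∧ z ∈ F₀) ∧
    (∀ z, infDist z (R₁.arc 2) ≤ r → z ∉ closure R.carrier ∧ z ∈ F₂)}

/-- **Upper spec** (what S4 consumes of `R₂`, the perturbed conjugate rectangle with caps behind
`(bc)`, `(da)` and collars at `(ab)`, `(cd)`; the set of admissible margins `r > 0`): the
TOPOLOGICAL CROSSING CLAUSE — every path within `r` of `closure R₂` from within `r` of
`R₂.arc 0` to within `r` of `R₂.arc 2` meets every path within `r` of `Ω` from within `r` of
`(ab)` to within `r` of `(cd)`. [folklore] -/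
def upperMargins (R R₂ : ConformalRectangle) : Set ℝ :=
  {r | 0 < r ∧ ∀ (p₁ p₃ q₀ q₂ : ℂ) (P : Path p₁ p₃) (Q : Path q₀ q₂),
    infDist p₁ (R₂.arc 0) ≤ r → infDist p₃ (R₂.arc 2) ≤ r →
    (∀ t, infDist (P t) (closure R₂.carrier) ≤ r) →
    infDist q₀ (R.arc 0) ≤ r → infDist q₂ (R.arc 2) ≤ r → (∀ s, infDist (Q s) R.carrier ≤ r) →
    ∃ t s, P t = Q s}

/-! ### Measurability of the block crossing event (used by the S4 bookkeeping) -/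

/-- The distance from a fixed point to (the carrier of) a configuration is a measurable function of
the configuration: `{infDist q c < t} = {N(univ) = 0} ∪ {N(ball q t) ≠ 0}` for `t > 0`. [folklore] -/
theorem measurable_infDist_coe (q : ℂ) : Measurable fun c : PointConfig ℂ => infDist q (c : Set ℂ) := by
  refine measurable_of_Iio fun t => ?_
  by_cases ht : t ≤ 0
  · have : (fun c : PointConfig ℂ => infDist q (c : Set ℂ)) ⁻¹' Iio t = ∅ := by
      ext c
      simp only [mem_preimage, mem_Iio, mem_empty_iff_false, iff_false, not_lt]
      exact ht.trans infDist_nonneg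
    rw [this]
    exact MeasurableSet.empty
  push Not at ht
  have key : (fun c : PointConfig ℂ => infDist q (c : Set ℂ)) ⁻¹' Iio t =
      {c | c.count univ = 0} ∪ {c | c.count (ball q t) ≠ 0} := by
    ext c
    simp only [mem_preimage, mem_Iio, mem_union, mem_setOf_eq, PointConfig.count, inter_univ,
      Set.encard_eq_zero, Set.encard_ne_zero]
    constructor
    · intro h
      by_cases hc : (c.carrier : Set ℂ) = ∅
      · exact Or.inl hc
      · right
        obtain ⟨y, hy, hyq⟩ := (infDist_lt_iff (Set.nonempty_iff_ne_empty.2 hc)).1 h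
        exact ⟨y, hy, by rwa [mem_ball, dist_comm]⟩
    · rintro (h | ⟨y, hy, hyq⟩)
      · have : infDist q (c : Set ℂ) = 0 := by
          rw [PointConfig.coe_eq_carrier, h]; exact infDist_empty
        rw [this]; exact ht
      · calc infDist q (c : Set ℂ) ≤ dist q y := infDist_le_dist_of_mem hy
          _ < t := by rwa [mem_ball, dist_comm] at hyq
  rw [key]
  exact ((PointConfig.measurable_count MeasurableSet.univ) (measurableSet_singleton _)).union
    ((PointConfig.measurable_count measurableSet_ball) (measurableSet_singleton _).compl)

/-- The distance from a fixed point to the DILATED carrier `s • c` (`s ≠ 0`) is measurable in `c`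
(`infDist_smul₀`). [folklore] -/
theorem measurable_infDist_smul (P : ℂ) {s : ℝ} (hs : s ≠ 0) :
    Measurable fun c : PointConfig ℂ => infDist P ((s : ℂ) • (c : Set ℂ)) := by
  have hs' : (s : ℂ) ≠ 0 := Complex.ofReal_ne_zero.mpr hs
  have h : ∀ c : PointConfig ℂ, infDist P ((s : ℂ) • (c : Set ℂ)) =
      ‖(s : ℂ)‖ * infDist ((s : ℂ)⁻¹ • P) (c : Set ℂ) := fun c => by
    conv_lhs => rw [show P = (s : ℂ) • ((s : ℂ)⁻¹ • P) by rw [smul_smul, mul_inv_cancel₀ hs', one_smul]]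
    exact infDist_smul₀ hs' _ _
  simp_rw [h]
  exact (measurable_infDist_coe _).const_mul _

/-- The colour of a fixed site of the block colouring is a measurable event (`s ≠ 0`). [folklore] -/
theorem measurableSet_mem_blockConfig (δ : ℝ) {s : ℝ} (hs : s ≠ 0) (y : (ℤ × ℤ) ⊕ (ℤ × ℤ)) :
    MeasurableSet {c : PointConfig ℂ × PointConfig ℂ | y ∈ blockConfig δ s c} :=
  measurableSet_le ((measurable_infDist_smul _ hs).comp measurable_fst)
    ((measurable_infDist_smul _ hs).comp measurable_snd)

/-- **The block crossing event is measurable** (`δ > 0`, `s ≠ 0`): the crude crossing event is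
determined by the finitely many sites of the window (`SmallCells.crudeCrossing_determinedBy`), and
each site colour is a measurable event.  This is what lets the S4 bookkeeping split the (possibly
non-measurable) white crossing event along `Block` (`measure_inter_add_diff`). [folklore] -/
theorem measurableSet_blockCrossing (R : ConformalRectangle) {δ : ℝ} (hδ : 0 < δ) {s : ℝ}
    (hs : s ≠ 0) :
    MeasurableSet {c : PointConfig ℂ × PointConfig ℂ | blockConfig δ s c ∈ crudeCrossing R δ} := by
  classical
  obtain ⟨ρ, hΩ⟩ := R.isBounded.subset_closedBall (0 : ℂ)
  set W : Set ((ℤ × ℤ) ⊕ (ℤ × ℤ)) := {y | (δ : ℂ) * zGs y ∈ R.carrier} with hWdef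
  have hWfin : W.Finite := (finite_setOf_dist_mul_zGs_le hδ 0 ρ).subset fun y hy => by
    have := hΩ hy
    rwa [mem_closedBall, dist_comm] at this
  have hF : (↑hWfin.toFinset : Set ((ℤ × ℤ) ⊕ (ℤ × ℤ))) = {y | (δ : ℂ) * zGs y ∈ R.carrier} :=
    hWfin.coe_toFinset
  have hdet := (Literature.Probability.Percolation.determinedBy_iff _ _).1
    (SmallCells.crudeCrossing_determinedBy R δ hF)
  rw [hF] at hdet
  have key : {c : PointConfig ℂ × PointConfig ℂ | blockConfig δ s c ∈ crudeCrossing R δ} =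
      ⋃ S ∈ {S : Set ((ℤ × ℤ) ⊕ (ℤ × ℤ)) | S ⊆ W ∧ S ∈ crudeCrossing R δ},
        {c | ∀ y ∈ W, (y ∈ blockConfig δ s c ↔ y ∈ S)} := by
    ext c
    simp only [mem_setOf_eq, mem_iUnion, exists_prop]
    constructor
    · intro hc
      refine ⟨blockConfig δ s c ∩ W, ⟨inter_subset_right, ?_⟩, fun y hy => ⟨fun h => ⟨h, hy⟩, fun h => h.1⟩⟩
      exact (hdet (blockConfig δ s c) (blockConfig δ s c ∩ W) (by rw [inter_assoc, inter_self])).1 hc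
    · rintro ⟨S, ⟨-, hSE⟩, hS⟩
      refine (hdet S (blockConfig δ s c) ?_).1 hSE
      ext y
      simp only [mem_inter_iff]
      constructor
      · rintro ⟨hyS, hyW⟩; exact ⟨(hS y hyW).2 hyS, hyW⟩
      · rintro ⟨hyb, hyW⟩; exact ⟨(hS y hyW).1 hyb, hyW⟩
  rw [key]
  refine Set.Finite.measurableSet_biUnion (hWfin.finite_subsets.subset fun S hS => hS.1) fun S _ => ?_
  have hI : {c : PointConfig ℂ × PointConfig ℂ | ∀ y ∈ W, (y ∈ blockConfig δ s c ↔ y ∈ S)} =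
      ⋂ y ∈ W, {c | (y ∈ blockConfig δ s c ↔ y ∈ S)} := by
    ext c
    simp only [mem_setOf_eq, mem_iInter]
  rw [hI]
  refine Set.Finite.measurableSet_biInter hWfin fun y _ => ?_
  by_cases hyS : y ∈ S
  · simp only [hyS, iff_true]
    exact measurableSet_mem_blockConfig δ hs y
  · simp only [hyS, iff_false]
    exact (measurableSet_mem_blockConfig δ hs y).compl

/-- **Registered sub-goal `stub_faithful_defs`** (carrier of this definitions module): the crude
block crossing event is measurable in the pair of nucleus configurations. [folklore] -/
theorem stub_faithful_defs : ∀ (R : ConformalRectangle) {δ : ℝ}, 0 < δ → ∀ {s : ℝ}, s ≠ 0 → MeasurableSet {c : PointConfig ℂ × PointConfig ℂ | blockConfig δ s c ∈ crudeCrossing R δ} :=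
  fun R _ hδ _ hs => measurableSet_blockCrossing R hδ hs

end Summit.CriticalPhenomena.CardyFormulaZ2.Cruxes.SquareFromVoronoiHub.VoronoiBlocks.Faithful

end
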